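import Mathlib.Probability.ProbabilityMassFunction.Constructions
import Mathlib.Probability.Moments.Variance
import Mathlib.Probability.Independence.Basic
import Literature.Computability.QuantumComplexity.CompositeSystemXEB
import HarnessLib

/-!
# Sample complexity of the empirical linear XEB: the variance / collision-probability bound

Topic `Literature/Computability/QuantumComplexity` (pub-qadeq lane, CLAIMS rows E-01…E-10 — the
XEB-scored random-circuit-sampling experiments report `F_XEB ± σ` from finitely many samples — and
§5.1 item S-7, where a partial spoof's score must be *verified* from its samples).

HONEST FRAMING: instance-level adjudication of specific advantage claims; no claim about BQP vs BPP
or the summit. This file proves Barak–Chou–Gao's two distribution-free lemmas on how many samples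
`x₁,…,x_T ∼ p` are needed before the empirical benchmark `(1/T) Σᵢ F_C(xᵢ)`,
`F_C(x) := 2ⁿ q_C(x) − 1`, is close to its population value `F_C(p)` (the tree's `linearXEB q p`):
Chebyshev with the variance of the per-sample score, and the bound of that variance by the
collision probability `Σₓ q_C(x)²` for their marginal sampler. Nothing is assumed about `q_C`
(no Porter–Thomas); the circuit-dependent part of their §6 (the `O(2⁻ⁿ)` collision probability of
deep 1D circuits, their §6.2, and the 2D conjecture) is NOT formalised.

## Contents (all proved, 0 named facts)

* `wmean w F`, `wvar w F` — mean and variance of a real statistic `F` under probability weights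
  `w` on a finite outcome type (plumbing); `wvar_le_sum_mul_sub_sq` (`Var ≤ E[(F − c)²]` for every
  constant `c`).
* `xebScore q x = N q(x) − 1` — the per-sample score `F_C(x)` whose `p`-mean is `F_C(p)`
  (`wmean_xebScore`) [cite: BarakChouGao2021, §1.1 and §6.1].
* `wvar_xebScore_le` — `Var_{x∼p}[F_C(x)] ≤ E_{x∼p}[2^{2n} q_C(x)²]` for every `p`, and
  **Lemma ‘variance to collision probability’** `wvar_xebScore_marginalSampler_le`:
  for the marginal sampler `A_C` on `m = |I|` sites, `Var_{x∼A_C}[F_C(x)] ≤ 2^{m+n} Σₓ q_C(x)²`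
  [cite: BarakChouGao2021, §6.1 Lemma ‘variance to collision prob’].
* **Lemma ‘sample complexity and variance’** in finite product-weight form (the `T` samples are
  the sequences `ω : Fin T → α` weighted by `Πᵢ p(ωᵢ)`): `sum_weight_sum_le_sub_le_wvar`
  (Chebyshev lower tail for a sum of i.i.d. draws of any real statistic, exact variance),
  `sum_weight_empXEB_le` (`Pr[(1/T) Σᵢ F_C(xᵢ) ≤ F_C(p) − ε] ≤ Var_{x∼p}[F_C(x)]/(T ε²)`) and
  `sum_weight_empXEB_le_of_le` (`≤ δ` once `T ≥ Var/(ε²δ)`)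
  [cite: BarakChouGao2021, §6.1 Lemma ‘sample complexity and variance’]; combined,
  `sum_weight_empXEB_marginalSampler_le_of_le`: `T ≥ 2^{m+n} Σₓ q_C(x)² /(ε²δ)` samples of `A_C`
  suffice [cite: BarakChouGao2021, §6.1 (both lemmas) and §1.1 (the sample-complexity lemma)].

* The primaries' error bar: under the reading "device = global-depolarizing mixture
  `F·q + (1 − F)·uniform` of the ideal `q`" (tree `depolarize`) WITH the Porter–Thomas moments
  `N Σ q² = 2`, `N² Σ q³ = 6` taken as hypotheses, the per-sample score has mean `F`
  (`wmean_xebScore_depolarize`) and variance `1 + 2F − F²` (`wvar_xebScore_depolarize`) — the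
  quantity under the square root in "the standard deviation of the estimate of `F` with `N_s`
  samples from the central limit theorem is `√((1 + 2F − F²)/N_s)`" — and the Chebyshev corollary
  `sum_weight_empXEB_depolarize_le` [cite: AruteEtAl2019, Supplementary Information §IV].

Proof method for the tail bounds (as in the tree's `MajorityVoteWeighted.lean` /
`MedianOfMeans.lean`): Mathlib's Chebyshev inequality `ProbabilityTheory.meas_ge_le_variance_div_sq`
under the product `Measure.pi` of the one-sample measure `PMF.toMeasure` of the weights, with
`ProbabilityTheory.variance_sum_pi`; the product measure of a finite set of sequences is read off
`Measure.pi_singleton`. Inside the proofs the finite outcome type carries the discrete measurable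
structure `⊤`; all STATEMENTS are finite sums.

## References

* [BarakChouGao2021] B. Barak, C.-N. Chou, X. Gao, *Spoofing linear cross-entropy benchmarking in
  shallow quantum circuits*, ITCS 2021 (LIPIcs 185, 30) = arXiv:2005.02421, §6 "Sample complexity
  analysis", §6.1 "A variance/collision probability approach": "Chebyshev's inequality implies that
  with `Var_{x∼p}[F_C(x)]/(ε²δ)` many samples, the empirical XEB is at least `F_C(p) − ε` with
  probability `δ` [sic] … Lemma. Let `C` be an `n`-qubit quantum circuit … For any pdf `p` and
  `ε, δ ∈ (0,1)`, we have `Pr_{x₁,…,x_T∼p}[(1/T) Σᵢ F_C(xᵢ) ≤ F_C(p) − ε] ≤ δ` when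
  `T ≥ Var_{x∼p}[F_C(x)]/(ε²δ)`. Proof. … by Chebyshev's inequality … `≤ Var_{x∼p}[F_C(x)]/(T·ε²)`";
  "Lemma. … `Var_{x∼A_C}[F_C(x)] ≤ 2^{m+n} Σₓ q_C(x)²` where `Σₓ q_C(x)²` is also known as the
  collision probability of `q_C`. Proof. `Var_{x∼A_C}[F_C(x)] ≤ E_{x∼A_C}[2^{2n} q_C(x)²] =
  2^{2n} Σₓ A_C(x) q_C(x)²`. Recall that `A_C(x) ≤ 2^{m−n}` for all `x`, thus … `≤ 2^{m+n} Σₓ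
  q_C(x)²`" (read via `lit read arxiv:2005.02421`, tex chunk p0013); §1.1 "From expectation to
  concentration", its sample-complexity lemma: "`T = Ω(2^m · (2ⁿ Σₓ q_C(x)²)/(ε²δ))`" (chunk
  p0004). Lemmas are cited by NAME / section because theorem counters differ between the arXiv
  rendering and the LIPIcs version.

* [AruteEtAl2019] F. Arute et al., *Quantum supremacy using a programmable superconducting
  processor*, Nature 574, 505 (2019), Supplementary Information §IV (cross-entropy benchmarking
  theory): "In practice, circuits of enough depth (as in the experiments reported here) exhibit the
  Porter-Thomas distribution for the measurement probabilities … `Pr(p) = D e^{−Dp}`. In this case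
  the linear cross entropy … gives `F = ⟨D p_s(q) − 1⟩`. The standard deviation of the estimate of
  `F` with `N_s` samples from the central limit theorem is `√((1 + 2F − F²)/N_s)`"
  (arXiv:1910.11333, tex chunk p0008 L53–69); §VIII ("The theoretical prediction of the statistical
  uncertainty, `√((1 + 2F − F²)/N_s)`, is `1.8 × 10⁻⁴`, which agrees with the experimental
  estimate", chunk p0027 L34).
* [BoulandFeffermanLandauLiu2022] A. Bouland, B. Fefferman, Z. Landau, Y. Liu, FOCS 2021, §1
  (global depolarizing model; the tree's `depolarize`).

## Design notes

* `F_C(p)` in BCG is the tree's `linearXEB q_C p` (`= 2ⁿ E_{x∼p} q_C(x) − 1`); `A_C` is the tree's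
  `marginalSampler I (marginalOn I q_C)` on `ι → σ` with `|σ| = 2`, `m = |I|`, `2ⁿ = |ι → σ|`
  (`CompositeSystemXEB.lean`); here `2^{m+n}` reads `|σ|^{|I|} · |ι → σ|`.
* Weights are real mass functions `w ≥ 0`, `Σ w = 1`, as everywhere in the lane's XEB files.
-/

noncomputable section

open Finset
open MeasureTheory ProbabilityTheory

namespace Literature.Computability.QuantumComplexity.XEB

open Literature.Barriers.QuantumAdvantage (linearXEB)

/-! ### Finite mean and variance of a statistic under probability weights -/

section Finite

variable {α : Type*} [Fintype α]

/-- The mean `Σₐ w(a) F(a)` of a real statistic under weights `w` (plumbing). [folklore] -/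
def wmean (w F : α → ℝ) : ℝ := ∑ a, w a * F a

/-- The variance `Σₐ w(a) (F(a) − mean)²` of a real statistic under weights `w` (plumbing).
[folklore] -/
def wvar (w F : α → ℝ) : ℝ := ∑ a, w a * (F a - wmean w F) ^ 2

/-- `Var ≥ 0` for nonnegative weights — the quantity `Var_{x∼p}[F_C(x)]` of the sample-complexity
lemma. [cite: BarakChouGao2021, §6.1 Lemma ‘sample complexity and variance’] -/
theorem wvar_nonneg {w : α → ℝ} (hw : ∀ a, 0 ≤ w a) (F : α → ℝ) : 0 ≤ wvar w F :=
  Finset.sum_nonneg fun a _ => mul_nonneg (hw a) (sq_nonneg _)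

/-- `Var[F] ≤ E[(F − c)²]` for every constant `c` (for probability weights): the step
"`Var_{x∼A_C}[F_C(x)] ≤ E_{x∼A_C}[2^{2n} q_C(x)²]`" is the case `c = −1`.
[cite: BarakChouGao2021, §6.1 proof of Lemma ‘variance to collision prob’] -/
theorem wvar_le_sum_mul_sub_sq {w : α → ℝ} (hw1 : ∑ a, w a = 1) (F : α → ℝ) (c : ℝ) :
    wvar w F ≤ ∑ a, w a * (F a - c) ^ 2 := by
  unfold wvar
  set μ := wmean w F with hμ
  -- `E[(F − c)²] = Var + (μ − c)²`
  have key : ∑ a, w a * (F a - c) ^ 2 = ∑ a, w a * (F a - μ) ^ 2 + (μ - c) ^ 2 := by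
    have h1 : ∀ a, w a * (F a - c) ^ 2 =
        w a * (F a - μ) ^ 2 + 2 * (μ - c) * (w a * F a) +
          ((μ - c) ^ 2 - 2 * (μ - c) * μ) * w a := by
      intro a; ring
    simp_rw [h1]
    rw [Finset.sum_add_distrib, Finset.sum_add_distrib, ← Finset.mul_sum, ← Finset.mul_sum, hw1]
    have : ∑ a, w a * F a = μ := rfl
    rw [this]
    ring
  rw [key]
  linarith [sq_nonneg (μ - c)]

/-- The **per-sample linear-XEB score** `F_C(x) = 2ⁿ q_C(x) − 1` (here `N = |α|` outcomes), whose
empirical mean over the samples is the measured benchmark `(1/T) Σᵢ 2ⁿ q_C(xᵢ) − 1`.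
[cite: BarakChouGao2021, §1.1 ("computing `(1/T) Σᵢ 2ⁿ q_C(xᵢ) − 1`") and §6] -/
def xebScore (q : α → ℝ) (x : α) : ℝ := (Fintype.card α : ℝ) * q x - 1

/-- The population value of the score is the benchmark: `E_{x∼p}[F_C(x)] = F_C(p)` (the tree's
`linearXEB q p`), for a distribution `p`. [cite: BarakChouGao2021, §6.1 proof of Lemma ‘sample
complexity and variance’ ("i.i.d. random variables with mean `F_C(p)`")] -/
theorem wmean_xebScore (q : α → ℝ) {p : α → ℝ} (hp1 : ∑ x, p x = 1) :
    wmean p (xebScore q) = linearXEB q p := by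
  unfold wmean xebScore linearXEB
  simp only [mul_sub, mul_one, Finset.sum_sub_distrib, hp1]
  congr 1
  rw [Finset.mul_sum]
  exact Finset.sum_congr rfl fun x _ => by ring

/-- First step of Lemma ‘variance to collision prob’, valid for EVERY sampled distribution `p`:
`Var_{x∼p}[F_C(x)] ≤ E_{x∼p}[2^{2n} q_C(x)²] = 2^{2n} Σₓ p(x) q_C(x)²`.
[cite: BarakChouGao2021, §6.1 proof of Lemma ‘variance to collision prob’] -/
theorem wvar_xebScore_le (q : α → ℝ) {p : α → ℝ} (hp1 : ∑ x, p x = 1) :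
    wvar p (xebScore q) ≤ (Fintype.card α : ℝ) ^ 2 * ∑ x, p x * q x ^ 2 := by
  refine (wvar_le_sum_mul_sub_sq hp1 (xebScore q) (-1)).trans (le_of_eq ?_)
  rw [Finset.mul_sum]
  exact Finset.sum_congr rfl fun x _ => by unfold xebScore; ring

end Finite

/-! ### Lemma ‘variance to collision probability’ for the marginal sampler -/

section Collision

variable {ι σ : Type*} [Fintype ι] [Fintype σ] [DecidableEq ι] [DecidableEq σ]

/-- For a distribution `q`, the marginal sampler's weights are capped: "`A_C(x) ≤ 2^{m−n}` for all
`x`" (here `q(I,x_I) ≤ 1`, so `A_C(x) = q(I,x_I)/|σ|^{n−m} ≤ 1/|σ|^{n−m}`).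
[cite: BarakChouGao2021, §6.1 proof of Lemma ‘variance to collision prob’] -/
theorem marginalSampler_marginalOn_le (I : Finset ι) {q : (ι → σ) → ℝ} (hq0 : ∀ y, 0 ≤ q y)
    (hq1 : ∑ y, q y = 1) (x : ι → σ) :
    marginalSampler I (marginalOn I q) x ≤
      ((Fintype.card σ : ℝ) ^ (Fintype.card ι - I.card))⁻¹ := by
  unfold marginalSampler
  rw [div_eq_mul_inv]
  refine mul_le_of_le_one_left (inv_nonneg.mpr (pow_nonneg (Nat.cast_nonneg _) _)) ?_
  -- `q(I, x_I) ≤ Σ_{x_I} q(I, x_I) = Σ_y q(y) = 1`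
  calc marginalOn I q (I.restrict x)
      ≤ ∑ xI, marginalOn I q xI :=
        Finset.single_le_sum (fun z _ => marginalOn_nonneg I hq0 z) (Finset.mem_univ _)
    _ = 1 := by rw [sum_marginalOn, hq1]

/-- **Lemma ‘variance to collision probability’**: for the marginal sampler `A_C` on the sites `I`
(`m = |I|`) of a distribution `q_C`,
`Var_{x∼A_C}[F_C(x)] ≤ 2^{m+n} Σₓ q_C(x)²` ("where `Σₓ q_C(x)²` is also known as the collision
probability of `q_C`"); here `2^{m+n}` reads `|σ|^{|I|} · |ι → σ|`.
[cite: BarakChouGao2021, §6.1 Lemma ‘variance to collision prob’] -/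
theorem wvar_xebScore_marginalSampler_le (I : Finset ι) {q : (ι → σ) → ℝ} (hq0 : ∀ y, 0 ≤ q y)
    (hq1 : ∑ y, q y = 1) (hσ : 0 < Fintype.card σ) :
    wvar (marginalSampler I (marginalOn I q)) (xebScore q) ≤
      (Fintype.card σ : ℝ) ^ I.card * Fintype.card (ι → σ) * ∑ x, q x ^ 2 := by
  have hA1 : ∑ x, marginalSampler I (marginalOn I q) x = 1 := by
    rw [sum_marginalSampler I _ hσ, sum_marginalOn, hq1]
  refine (wvar_xebScore_le q hA1).trans ?_
  -- `2^{2n} Σ A_C(x) q(x)² ≤ 2^{2n} · 2^{m−n} Σ q(x)² = 2^{m+n} Σ q(x)²`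
  set N : ℝ := (Fintype.card (ι → σ) : ℝ) with hN
  set s : ℝ := (Fintype.card σ : ℝ) with hs
  have hspos : 0 < s := by rw [hs]; exact_mod_cast hσ
  have hcap := marginalSampler_marginalOn_le I hq0 hq1
  have hNfac : N = s ^ I.card * s ^ (Fintype.card ι - I.card) := card_fun_eq_pow_mul_pow I
  calc N ^ 2 * ∑ x, marginalSampler I (marginalOn I q) x * q x ^ 2
      ≤ N ^ 2 * ∑ x, (s ^ (Fintype.card ι - I.card))⁻¹ * q x ^ 2 := by
        gcongr with x
        exact hcap x
    _ = s ^ I.card * N * ∑ x, q x ^ 2 := by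
        rw [← Finset.mul_sum, ← mul_assoc, hNfac]
        have hne : s ^ (Fintype.card ι - I.card) ≠ 0 := pow_ne_zero _ hspos.ne'
        field_simp

end Collision

/-! ### Lemma ‘sample complexity and variance’ (Chebyshev), finite product-weight form -/

section Chebyshev

variable {α : Type*} [Fintype α]

/-- **Chebyshev lower tail for the sum of `T` i.i.d. draws of a real statistic** (exact variance):
for probability weights `w` on a finite `α`, any `F : α → ℝ`, any `T` and `a > 0`, the product
weight of the sequences `ω : Fin T → α` with `Σᵢ F(ωᵢ) ≤ T·E_w[F] − a` is at most `T·Var_w[F]/a²`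
("`{F_C(xᵢ)}` are i.i.d. random variables with mean `F_C(p)` and variance `Var_{x∼p}[F_C(x)]`, by
Chebyshev's inequality …"). [cite: BarakChouGao2021, §6.1 proof of Lemma ‘sample complexity and
variance’] -/
theorem sum_weight_sum_le_sub_le_wvar (w : α → ℝ) (hw : ∀ a, 0 ≤ w a) (hw1 : ∑ a, w a = 1)
    (F : α → ℝ) (T : ℕ) {a : ℝ} (ha : 0 < a) :
    ∑ ω ∈ univ.filter (fun ω : Fin T → α => (∑ i, F (ω i)) ≤ T * wmean w F - a), ∏ i, w (ω i)
      ≤ T * wvar w F / a ^ 2 := by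
  classical
  letI : MeasurableSpace α := ⊤
  haveI : MeasurableSingletonClass α := ⟨fun _ => MeasurableSpace.measurableSet_top⟩
  -- one draw: the measure with the weights `w`
  have hsum : ∑ a, ENNReal.ofReal (w a) = 1 := by
    rw [← ENNReal.ofReal_sum_of_nonneg (fun a _ => hw a), hw1, ENNReal.ofReal_one]
  set p : PMF α := PMF.ofFintype (fun a => ENNReal.ofReal (w a)) hsum with hp
  set μ : Measure α := p.toMeasure with hμ
  have hμa : ∀ b : α, μ {b} = ENNReal.ofReal (w b) := fun b => by
    rw [hμ, p.toMeasure_apply_singleton b (measurableSet_singleton b), hp, PMF.ofFintype_apply]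
  have hsing : ∀ b : α, μ.real {b} = w b := fun b => by
    rw [measureReal_def, hμa, ENNReal.toReal_ofReal (hw b)]
  -- the statistic is bounded (finite type), hence in `L²`
  set S : ℝ := ∑ b, |F b| with hS
  have hFbdd : ∀ᵐ b ∂μ, F b ∈ Set.Icc (-S) S := ae_of_all _ fun b => by
    have hb : |F b| ≤ S := Finset.single_le_sum (fun c _ => abs_nonneg (F c)) (Finset.mem_univ b)
    exact ⟨by linarith [neg_abs_le (F b)], by linarith [le_abs_self (F b)]⟩
  have hFmeas : Measurable F := measurable_of_finite F
  have hFLp : MemLp F 2 μ := memLp_of_bounded hFbdd hFmeas.aestronglyMeasurable 2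
  -- mean and variance of one draw are the finite sums
  have hmean : μ[F] = wmean w F := by
    rw [integral_fintype (MemLp.integrable (by norm_num) hFLp)]
    simp only [hsing, smul_eq_mul, wmean]
  have hvar : Var[F; μ] = wvar w F := by
    rw [variance_eq_integral hFmeas.aemeasurable, integral_fintype (Integrable.of_finite)]
    simp only [hsing, smul_eq_mul, wvar, hmean]
  -- `T` independent draws
  set P : Measure (Fin T → α) := Measure.pi fun _ : Fin T => μ with hP
  set X : (Fin T → α) → ℝ := ∑ i : Fin T, fun ω => F (ω i) with hX
  have hXapply : ∀ ω, X ω = ∑ i, F (ω i) := fun ω => by simp [hX, Finset.sum_apply]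
  have hXLp : MemLp X 2 P := by
    refine memLp_finsetSum' _ fun i _ => ?_
    exact hFLp.comp_measurePreserving (measurePreserving_eval (fun _ : Fin T => μ) i)
  have hXvar : Var[X; P] = T * wvar w F := by
    rw [hX, hP, variance_sum_pi fun _ => hFLp]
    simp only [Finset.sum_const, Finset.card_univ, Fintype.card_fin, nsmul_eq_mul, hvar]
  have hXmean : P[X] = T * wmean w F := by
    have hint : ∀ i : Fin T, ∫ ω, F (ω i) ∂P = μ[F] := fun i => by
      have hmp := measurePreserving_eval (fun _ : Fin T => μ) i
      rw [← hmp.map_eq, integral_map (measurable_pi_apply i).aemeasurable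
        hFmeas.aestronglyMeasurable]
    have : P[X] = ∑ i : Fin T, ∫ ω, F (ω i) ∂P := by
      rw [hX, ← integral_finsetSum _ fun i _ => ?_]
      · simp only [Finset.sum_apply]
      · exact MemLp.integrable (by norm_num)
          (hFLp.comp_measurePreserving (measurePreserving_eval (fun _ : Fin T => μ) i))
    rw [this]
    simp only [hint, hmean, Finset.sum_const, Finset.card_univ, Fintype.card_fin, nsmul_eq_mul]
  -- the event lies inside the Chebyshev tail `{a ≤ |X − E X|}`
  set B : Finset (Fin T → α) :=
    univ.filter fun ω : Fin T → α => (∑ i, F (ω i)) ≤ T * wmean w F - a with hB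
  have hsub : (B : Set (Fin T → α)) ⊆ {ω | a ≤ |X ω - P[X]|} := by
    intro ω hω
    rw [Finset.mem_coe, hB, Finset.mem_filter] at hω
    rw [Set.mem_setOf_eq, hXapply ω, hXmean]
    calc a ≤ -(∑ i, F (ω i) - T * wmean w F) := by linarith [hω.2]
      _ ≤ |∑ i, F (ω i) - T * wmean w F| := neg_le_abs _
  have hcheb := meas_ge_le_variance_div_sq hXLp ha
  have hPB : P B ≤ ENNReal.ofReal (T * wvar w F / a ^ 2) := by
    refine ((measure_mono hsub).trans hcheb).trans (le_of_eq ?_)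
    rw [hXvar]
  -- read the product measure of `B` as the product weight
  have hPB' : P B = ENNReal.ofReal (∑ ω ∈ B, ∏ i, w (ω i)) := by
    rw [← sum_measure_singleton, ENNReal.ofReal_sum_of_nonneg
      (fun ω _ => Finset.prod_nonneg fun i _ => hw (ω i))]
    refine Finset.sum_congr rfl fun ω _ => ?_
    rw [hP, Measure.pi_singleton, ENNReal.ofReal_prod_of_nonneg (fun i _ => hw (ω i))]
    exact Finset.prod_congr rfl fun i _ => hμa (ω i)
  rw [hPB'] at hPB
  have hnn : 0 ≤ ∑ ω ∈ B, ∏ i, w (ω i) :=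
    Finset.sum_nonneg fun ω _ => Finset.prod_nonneg fun i _ => hw (ω i)
  have hrhs : 0 ≤ T * wvar w F / a ^ 2 :=
    div_nonneg (mul_nonneg (Nat.cast_nonneg _) (wvar_nonneg hw F)) (sq_nonneg _)
  exact (ENNReal.ofReal_le_ofReal_iff hrhs).mp hPB

/-- **Lemma ‘sample complexity and variance’** (Chebyshev form): for every distribution `p` and
every `ε > 0`, the weight of the sample sequences `x₁,…,x_T ∼ p` (i.i.d.) whose empirical
benchmark satisfies `(1/T) Σᵢ F_C(xᵢ) ≤ F_C(p) − ε` is at most `Var_{x∼p}[F_C(x)] / (T ε²)`.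
[cite: BarakChouGao2021, §6.1 proof of Lemma ‘sample complexity and variance’] -/
theorem sum_weight_empXEB_le (q : α → ℝ) {p : α → ℝ} (hp0 : ∀ x, 0 ≤ p x) (hp1 : ∑ x, p x = 1)
    {T : ℕ} (hT : 0 < T) {ε : ℝ} (hε : 0 < ε) :
    ∑ ω ∈ univ.filter (fun ω : Fin T → α =>
        (∑ i, xebScore q (ω i)) / T ≤ linearXEB q p - ε), ∏ i, p (ω i)
      ≤ wvar p (xebScore q) / (T * ε ^ 2) := by
  have hT' : (0 : ℝ) < T := by exact_mod_cast hT
  have h := sum_weight_sum_le_sub_le_wvar p hp0 hp1 (xebScore q) T (mul_pos hT' hε)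
  rw [wmean_xebScore q hp1] at h
  have hset : (univ.filter fun ω : Fin T → α => (∑ i, xebScore q (ω i)) / T ≤ linearXEB q p - ε) =
      univ.filter fun ω : Fin T → α => (∑ i, xebScore q (ω i)) ≤ T * linearXEB q p - T * ε := by
    ext ω
    simp only [Finset.mem_filter, Finset.mem_univ, true_and]
    rw [div_le_iff₀ hT']
    constructor <;> intro h' <;> nlinarith
  rw [hset]
  refine h.trans (le_of_eq ?_)
  field_simp

/-- … hence **`T ≥ Var_{x∼p}[F_C(x)]/(ε²δ)` samples suffice**: then that weight is at most `δ`
("`Pr_{x₁,…,x_T∼p}[(1/T) Σᵢ F_C(xᵢ) ≤ F_C(p) − ε] ≤ δ` when `T ≥ Var_{x∼p}[F_C(x)]/(ε²δ)`").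
[cite: BarakChouGao2021, §6.1 Lemma ‘sample complexity and variance’] -/
theorem sum_weight_empXEB_le_of_le (q : α → ℝ) {p : α → ℝ} (hp0 : ∀ x, 0 ≤ p x)
    (hp1 : ∑ x, p x = 1) {T : ℕ} (hT : 0 < T) {ε δ : ℝ} (hε : 0 < ε) (hδ : 0 < δ)
    (hTge : wvar p (xebScore q) / (ε ^ 2 * δ) ≤ T) :
    ∑ ω ∈ univ.filter (fun ω : Fin T → α =>
        (∑ i, xebScore q (ω i)) / T ≤ linearXEB q p - ε), ∏ i, p (ω i) ≤ δ := by
  refine (sum_weight_empXEB_le q hp0 hp1 hT hε).trans ?_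
  have hT' : (0 : ℝ) < T := by exact_mod_cast hT
  rw [div_le_iff₀ (mul_pos hT' (sq_pos_of_pos hε))]
  rw [div_le_iff₀ (mul_pos (sq_pos_of_pos hε) hδ)] at hTge
  linarith

end Chebyshev

/-! ### The two lemmas combined for the marginal sampler -/

section Combined

variable {ι σ : Type*} [Fintype ι] [Fintype σ] [DecidableEq ι] [DecidableEq σ]

/-- **Sample complexity of verifying the marginal sampler's score** (the two §6.1 lemmas combined,
as announced in §1.1: "`T = Ω(2^m · (2ⁿ Σₓ q_C(x)²)/(ε²δ))`"): if
`T ≥ 2^{m+n} Σₓ q_C(x)² / (ε²δ)` then the weight of the sample sequences `x₁,…,x_T ∼ A_C` with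
`(1/T) Σᵢ F_C(xᵢ) ≤ F_C(A_C) − ε` is at most `δ`.
[cite: BarakChouGao2021, §6.1 (Lemmas ‘sample complexity and variance’ and ‘variance to collision
prob’) and §1.1 (the sample-complexity lemma)] -/
theorem sum_weight_empXEB_marginalSampler_le_of_le (I : Finset ι) {q : (ι → σ) → ℝ}
    (hq0 : ∀ y, 0 ≤ q y) (hq1 : ∑ y, q y = 1) (hσ : 0 < Fintype.card σ) {T : ℕ} (hT : 0 < T)
    {ε δ : ℝ} (hε : 0 < ε) (hδ : 0 < δ)
    (hTge : (Fintype.card σ : ℝ) ^ I.card * Fintype.card (ι → σ) * (∑ x, q x ^ 2) / (ε ^ 2 * δ)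
      ≤ T) :
    ∑ ω ∈ univ.filter (fun ω : Fin T → (ι → σ) =>
        (∑ i, xebScore q (ω i)) / T ≤ linearXEB q (marginalSampler I (marginalOn I q)) - ε),
      ∏ i, marginalSampler I (marginalOn I q) (ω i) ≤ δ := by
  have hA0 : ∀ x, 0 ≤ marginalSampler I (marginalOn I q) x :=
    marginalSampler_nonneg I (marginalOn_nonneg I hq0)
  have hA1 : ∑ x, marginalSampler I (marginalOn I q) x = 1 := by
    rw [sum_marginalSampler I _ hσ, sum_marginalOn, hq1]
  refine sum_weight_empXEB_le_of_le q hA0 hA1 hT hε hδ ?_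
  refine le_trans ?_ hTge
  exact div_le_div_of_nonneg_right (wvar_xebScore_marginalSampler_le I hq0 hq1 hσ)
    (le_of_lt (mul_pos (sq_pos_of_pos hε) hδ))

end Combined

/-! ### The primaries' Porter–Thomas error bar (Arute et al., Supplementary Information §IV) -/

section PorterThomas

variable {α : Type*} [Fintype α]

open Literature.Barriers.QuantumAdvantage (depolarize linearXEB_depolarize)

/-- `Var_w[F] = E_w[F²] − (E_w[F])²` for probability weights (plumbing for the per-sample variance
behind the primaries' CLT error bar). [cite: AruteEtAl2019, Supplementary Information §IV (XEB
theory: "the standard deviation of the estimate of F with N_s samples")] -/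
theorem wvar_eq_sub_sq {w : α → ℝ} (hw1 : ∑ a, w a = 1) (F : α → ℝ) :
    wvar w F = ∑ a, w a * F a ^ 2 - wmean w F ^ 2 := by
  unfold wvar
  set μ := wmean w F with hμ
  have h1 : ∀ a, w a * (F a - μ) ^ 2 = w a * F a ^ 2 - 2 * μ * (w a * F a) + μ ^ 2 * w a := by
    intro a; ring
  simp_rw [h1]
  rw [Finset.sum_add_distrib, Finset.sum_sub_distrib, ← Finset.mul_sum, ← Finset.mul_sum, hw1]
  have : ∑ a, w a * F a = μ := rfl
  rw [this]
  ring

/-- The global depolarizing mixture of a distribution is nonnegative for `0 ≤ F ≤ 1`.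
[cite: BoulandFeffermanLandauLiu2022, §1 (footnote on global depolarizing noise)] -/
theorem depolarize_nonneg {q : α → ℝ} (hq0 : ∀ x, 0 ≤ q x) {F : ℝ} (hF0 : 0 ≤ F) (hF1 : F ≤ 1)
    (x : α) : 0 ≤ depolarize F q x := by
  unfold depolarize
  exact add_nonneg (mul_nonneg hF0 (hq0 x))
    (mul_nonneg (by linarith) (inv_nonneg.mpr (Nat.cast_nonneg _)))

/-- **The primaries' reading of the score**: if the device samples from the global-depolarizing
mixture `F·q + (1 − F)·uniform` of the IDEAL distribution `q` (the tree's `depolarize F q`) and `q`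
has the Porter–Thomas second moment `N Σₓ q(x)² = 2`, the per-sample score `N q(x) − 1` has mean
`F` — "circuits of enough depth … exhibit the Porter-Thomas distribution … In this case the linear
cross entropy … gives `F = ⟨D p_s(q) − 1⟩`". The Porter–Thomas moment is a HYPOTHESIS here, never a
theorem about any circuit. [cite: AruteEtAl2019, Supplementary Information §IV (XEB theory), the
Porter–Thomas paragraph] -/
theorem wmean_xebScore_depolarize [Nonempty α] (q : α → ℝ) (hq1 : ∑ x, q x = 1)
    (h2 : (Fintype.card α : ℝ) * ∑ x, q x ^ 2 = 2) (F : ℝ) :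
    wmean (depolarize F q) (xebScore q) = F := by
  rw [wmean_xebScore q (sum_depolarize F hq1), linearXEB_depolarize q q hq1 F]
  unfold linearXEB
  have : ∑ x, q x * q x = ∑ x, q x ^ 2 := Finset.sum_congr rfl fun x _ => by ring
  rw [this, h2]
  ring

/-- … and, granting also the Porter–Thomas third moment `N² Σₓ q(x)³ = 6`, its variance is
`1 + 2F − F²` — the per-sample variance behind "The standard deviation of the estimate of `F` with
`N_s` samples from the central limit theorem is `√((1 + 2F − F²)/N_s)`" (the CLT step itself is not
formalised; the distribution-free Chebyshev form is `sum_weight_empXEB_le`).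
[cite: AruteEtAl2019, Supplementary Information §IV (XEB theory), the Porter–Thomas paragraph] -/
theorem wvar_xebScore_depolarize [Nonempty α] (q : α → ℝ) (hq1 : ∑ x, q x = 1)
    (h2 : (Fintype.card α : ℝ) * ∑ x, q x ^ 2 = 2)
    (h3 : (Fintype.card α : ℝ) ^ 2 * ∑ x, q x ^ 3 = 6) (F : ℝ) :
    wvar (depolarize F q) (xebScore q) = 1 + 2 * F - F ^ 2 := by
  have hN : (Fintype.card α : ℝ) ≠ 0 := by exact_mod_cast Fintype.card_ne_zero
  set N : ℝ := (Fintype.card α : ℝ) with hNdef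
  have hsum : ∑ x, depolarize F q x = 1 := sum_depolarize F hq1
  rw [wvar_eq_sub_sq hsum, wmean_xebScore_depolarize q hq1 h2 F]
  -- second moment `Σₓ p(x) (N q(x) − 1)²`, `p = F q + (1 − F)/N`, expanded in the moments of `q`
  have hsq : ∑ x, depolarize F q x * xebScore q x ^ 2 =
      F * (N ^ 2 * ∑ x, q x ^ 3) - 2 * F * (N * ∑ x, q x ^ 2) + F * ∑ x, q x
        + (1 - F) * (N * ∑ x, q x ^ 2) - 2 * (1 - F) * ∑ x, q x
        + (1 - F) * (N⁻¹ * ∑ _x : α, (1 : ℝ)) := by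
    unfold depolarize xebScore
    simp only [Finset.mul_sum, ← Finset.sum_add_distrib, ← Finset.sum_sub_distrib]
    refine Finset.sum_congr rfl fun x _ => ?_
    field_simp
    ring
  rw [hsq, h3, h2, hq1]
  simp only [Finset.sum_const, Finset.card_univ, nsmul_eq_mul, mul_one]
  rw [← hNdef]
  field_simp
  ring

/-- Consequently (Chebyshev, `sum_weight_empXEB_le`): under that reading, `T` samples put the
empirical benchmark below `F − ε` with weight at most `(1 + 2F − F²)/(T ε²)` — the variance the
primaries divide by `N_s` under the square root.
[cite: AruteEtAl2019, Supplementary Information §IV (XEB theory), the Porter–Thomas paragraph]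
[cite: BarakChouGao2021, §6.1 Lemma ‘sample complexity and variance’] -/
theorem sum_weight_empXEB_depolarize_le [Nonempty α] (q : α → ℝ) (hq0 : ∀ x, 0 ≤ q x)
    (hq1 : ∑ x, q x = 1) (h2 : (Fintype.card α : ℝ) * ∑ x, q x ^ 2 = 2)
    (h3 : (Fintype.card α : ℝ) ^ 2 * ∑ x, q x ^ 3 = 6) {F : ℝ} (hF0 : 0 ≤ F) (hF1 : F ≤ 1)
    {T : ℕ} (hT : 0 < T) {ε : ℝ} (hε : 0 < ε) :
    ∑ ω ∈ univ.filter (fun ω : Fin T → α => (∑ i, xebScore q (ω i)) / T ≤ F - ε),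
        ∏ i, depolarize F q (ω i)
      ≤ (1 + 2 * F - F ^ 2) / (T * ε ^ 2) := by
  have h := sum_weight_empXEB_le q (depolarize_nonneg hq0 hF0 hF1) (sum_depolarize F hq1) hT hε
  rw [wvar_xebScore_depolarize q hq1 h2 h3 F, ← wmean_xebScore q (sum_depolarize F hq1),
    wmean_xebScore_depolarize q hq1 h2 F] at h
  exact h

end PorterThomas

end Literature.Computability.QuantumComplexity.XEB

end
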